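import Mathlib
import Summits.NavierStokesRegularity.NavierStokesRegularity.Theses.TransitMassLedger
import Summits.NavierStokesRegularity.NavierStokesRegularity.Theorems.WakeRatchetTailRatchet.Negative.TailRatchetFalseOfDyadicScalarFronts
import Literature.Analysis.FluidPDE.Tao2016AveragedNS.SelfSimilarCascadeBlowup
import HarnessLib

/-!
# `TransitMassLedger.LedgerRigidity` — the dyadic member's outflow-coercive mass certificate, in kernel
# (first landing for item stmt-NavierStokesRegularity-24398; `--supports`)

The hypothesis class of `LedgerRigidity` (and the negated hypothesis of `BackscatterRigidity`) is the
existence of an OUTFLOW-COERCIVE MASS CERTIFICATE `(ℓ, θ, κ)` of a table `α` on the unit ball: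
`κ‖A x − A y‖² ≤ ⟪ℓ, Q x + A x + B(y,x)⟫ + θ x − θ y` for `‖x‖, ‖y‖ ≤ 1`, `κ > 0`, `θ` continuous,
`θ 0 = 0` (`Q, A, B` = `tableQ α, tableA α, tableB α`).  The route's instrument (kit j295767) found the
degree-1 certificate LMI feasible and TIGHT for the scalar dyadic member `dyadicTable ∈ E₂(2)`; this
file lands that certificate by hand, kernel-checked: `ℓ = e₀`, `θ(x) = −½ x₀²`, `κ = 1/8`.  Indeed
`Q = 0`, `A x = x₀² e₀`, `B(y,x) = −x₀y₀ e₀`, so the right-hand side is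
`x₀² − x₀y₀ − ½x₀² + ½y₀² = ½(x₀ − y₀)²`, while `‖A x − A y‖² = (x₀² − y₀²)² = (x₀−y₀)²(x₀+y₀)² ≤ 4(x₀−y₀)²`
on the unit ball — the Katz–Pavlović ledger `L = Σ_n X_n`, `dL/ds = ½ Σ_n (X_n − X_(n+1))²`.
Consequently the dyadic member lies in the FEED-FORWARD regime of the route's dichotomy
(`dyadicTable_feedForward`): `LedgerRigidity` — not `BackscatterRigidity` — is the crux that
speaks about it.

HONEST FRAMING: statements about the structure maps of a MODEL lattice ODE (Tao 2016 §1.2, §4);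
nothing here concerns the Navier–Stokes equations.  No item is closed by this file.
-/

noncomputable section

set_option linter.dupNamespace false

namespace Summit.NavierStokesRegularity.NavierStokesRegularity.Theorems

namespace TransitMassLedgerDyadicCertificate

open Literature.Analysis.FluidPDE Literature.Analysis.FluidPDE.TaoCascade
open WakeRatchetDyadicFront

/-- A coordinate of a vector of the unit ball of `ℝ⁴` has modulus at most one. [folklore] -/
theorem abs_apply_le_one {x : EuclideanSpace ℝ (Fin 4)} (hx : ‖x‖ ≤ 1) (i : Fin 4) : |x i| ≤ 1 :=
  (abs_apply_le_norm x i).trans hx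

/-- **The dyadic member's hand certificate** (`ℓ = e₀`, `θ = −½x₀²`, `κ = 1/8`): for `‖x‖, ‖y‖ ≤ 1`,
`(1/8)‖A x − A y‖² ≤ ⟪e₀, Q x + A x + B(y,x)⟫ − ½x₀² + ½y₀²` for the dyadic table — the pointwise
form of the Katz–Pavlović mass ledger `d(Σ X_n)/ds = ½Σ(X_n − X_(n+1))²`.
[cite: Tao2016AveragedNS, §1.2 (dyadic Katz–Pavlović system); BarbatoMorandinRomito2011 (Lyapunov control of the scalar dyadic model); route TransitMassLedger BC5 rung] -/
theorem dyadicTable_certificate (x y : EuclideanSpace ℝ (Fin 4)) (hx : ‖x‖ ≤ 1) (hy : ‖y‖ ≤ 1) :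
    (1 / 8 : ℝ) * ‖tableA dyadicTable x - tableA dyadicTable y‖ ^ 2 ≤
      inner ℝ (EuclideanSpace.single (0 : Fin 4) (1 : ℝ))
          (tableQ dyadicTable x + tableA dyadicTable x + tableB dyadicTable y x)
        + (-(1 / 2 : ℝ) * x 0 ^ 2) - (-(1 / 2 : ℝ) * y 0 ^ 2) := by
  rw [tableQ_dyadicTable, tableA_dyadicTable, tableA_dyadicTable, tableB_dyadicTable, zero_add,
    ← sub_smul, ← add_smul]
  rw [norm_smul, PiLp.norm_single, norm_one, mul_one, Real.norm_eq_abs,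
    inner_smul_right, EuclideanSpace.inner_single_left]
  simp only [map_one, one_mul, PiLp.single_apply, if_true]
  have hx0 : |x 0| ≤ 1 := abs_apply_le_one hx 0
  have hy0 : |y 0| ≤ 1 := abs_apply_le_one hy 0
  rw [sq_abs]
  have h1 : (x 0 + y 0) ^ 2 ≤ 4 := by
    have := abs_add_le (x 0) (y 0)
    nlinarith [abs_nonneg (x 0 + y 0), sq_abs (x 0 + y 0)]
  nlinarith [sq_nonneg (x 0 - y 0), h1, mul_nonneg (sq_nonneg (x 0 - y 0)) (sub_nonneg.2 h1)]

/-- **The dyadic member admits an outflow-coercive mass certificate** (kit j295767: the degree-1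
certificate LMI is feasible and tight for `dyadicTable`; here by hand, `ℓ = e₀, θ = −½x₀², κ = 1/8`).
[cite: Tao2016AveragedNS, §1.2; BarbatoMorandinRomito2011; route TransitMassLedger BC5 rung] -/
theorem hasMassCertificate_dyadicTable :
    ∃ (ℓ : EuclideanSpace ℝ (Fin 4)) (θ : EuclideanSpace ℝ (Fin 4) → ℝ) (κ : ℝ),
      0 < κ ∧ Continuous θ ∧ θ 0 = 0 ∧
        ∀ x y : EuclideanSpace ℝ (Fin 4), ‖x‖ ≤ 1 → ‖y‖ ≤ 1 →
          κ * ‖tableA dyadicTable x - tableA dyadicTable y‖ ^ 2 ≤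
            inner ℝ ℓ (tableQ dyadicTable x + tableA dyadicTable x + tableB dyadicTable y x)
              + θ x - θ y := by
  refine ⟨EuclideanSpace.single (0 : Fin 4) (1 : ℝ), fun x => -(1 / 2 : ℝ) * x 0 ^ 2, 1 / 8,
    by norm_num, ?_, by simp, fun x y hx hy => dyadicTable_certificate x y hx hy⟩
  have h0 : Continuous fun x : EuclideanSpace ℝ (Fin 4) => x 0 := PiLp.continuous_apply 2 _ 0
  exact continuous_const.mul (h0.pow 2)

/-- **The dyadic member is in the feed-forward regime of the route's dichotomy**: for every `R ≥ 2`
it is a table of `E₂(R)` to which `BackscatterRigidity`'s hypothesis `¬ ∃ certificate` does NOT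
apply — `LedgerRigidity` is the crux that governs it.
[cite: Tao2016AveragedNS, §1.2, §4 (4.2)–(4.3); route TransitMassLedger (regime dichotomy)] -/
theorem dyadicTable_feedForward {R : ℝ} (hR : 2 ≤ R) :
    InTableClass R dyadicTable ∧
      ∃ (ℓ : EuclideanSpace ℝ (Fin 4)) (θ : EuclideanSpace ℝ (Fin 4) → ℝ) (κ : ℝ),
        0 < κ ∧ Continuous θ ∧ θ 0 = 0 ∧
          ∀ x y : EuclideanSpace ℝ (Fin 4), ‖x‖ ≤ 1 → ‖y‖ ≤ 1 →
            κ * ‖tableA dyadicTable x - tableA dyadicTable y‖ ^ 2 ≤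
              inner ℝ ℓ (tableQ dyadicTable x + tableA dyadicTable x + tableB dyadicTable y x)
                + θ x - θ y :=
  ⟨inTableClass_dyadicTable hR, hasMassCertificate_dyadicTable⟩

end TransitMassLedgerDyadicCertificate

end Summit.NavierStokesRegularity.NavierStokesRegularity.Theorems

end
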